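import Literature.AlgebraicGeometry.HodgeTheory.CMHodgeGroupCentreKWeil
import Literature.AlgebraicGeometry.HodgeTheory.CMHodgeGroupOneBalancedPlace
import HarnessLib

/-!
# `Lie Hg ⊗ ℂ ⊇ (𝔲_E ∩ 𝔰𝔲_K)(V,ψ) ⊗ ℂ` for a sextic CM field with one balanced place and a `K`-WEIL structure
# (TABLE X row 13: the `K`-Weil members of the pattern `(2,2,1)`) — Moonen–Zarhin 1998 §4, 1999 (2.3); Ribet 1983

Family `hodge`, layer `Literature/AlgebraicGeometry/HodgeTheory` (cell `pub-hodgeav-hg6`, req-37 (A) Q2b, TABLE X ROW 13, eng-3 g3,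
job B6 row 13; companion of eng-5 g6's `CMHodgeGroupOneBalancedPlace`, whose hypothesis `hnoWeil` EXCLUDES exactly these
members). UNCONDITIONAL; theorems only, no definition, no named fact, no `sorry`. HONEST FRAMING of that cell: HC ∕ HC_AV ∕
HC_CM ∕ H2 NOT proved — linear algebra of polarized weight-one `ℚ`-Hodge structures.

SETTING: `H` effective polarized of weight `1`, `E = End_Hdg(V) = ℚ[φ]` of dimension `2|ι| ≤ 6` with every non-zero element
invertible, a CM type `μ` with blocks `W_{μ k}` of rank `2`, ONE balanced place `k₀` and two unbalanced places `k₁ ≠ k₂` with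
`dim W_{μ k₁}^{1,0} + dim W_{μ k₂}^{1,0} = 2` (the `K`-signature `(g/2, g/2)` along `μ`), and THE `K`-DATUM: a `ψ`-skew
`φ_K ∈ E` acting by one scalar `μ_K ≠ 0` on every `W_{μ k}` (so `⊕_k W_{μ k} = W_K := ker(φ_{K,ℂ} − μ_K)`). For these members
`Hg ⊆ U_E ∩ SU_K`; the theorem below is the reverse inclusion in Lie form, for EVERY member (no genericity).
* §1 **`CMThetaSocket.mem_spanC_of_lift_of_centre_kWeil`** — the socket with ONE trace condition: LIFT + «centre ⊇ 𝔷₀»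
  (`CMThetaCentre.centre_of_pair_kWeil`'s conclusion) ⟹ every `φ_ℂ`-commuting `ψ_ℂ`-skew `Y` with `Σ_k tr(Y|W_{μ k}) = 0`
  lies in `𝔤_ℂ` (lift the traceless parts of the `Y|W_{μ k}`, add the central element with scalars `tr(Y|W_{μ k})/2`, and
  conclude by `CMThetaSocket.eq_zero_of_forall_eigenspace`).
* §2 **`CMThetaOneBalancedKWeil.mem_spanC_of_commute_of_skew_of_traces`** (any admissible bracket-closed `𝔤 ∋ Θ_ℂ`) and
  **`CMThetaOneBalancedKWeil.mem_hodgeLieC_of_commute_of_skew_of_traces`** (`𝔤 = Lie Hg(H)`): ASSEMBLY = LIFT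
  (`CMNoTwist.lift_of_unique_balanced` with `CMIrred.eigenspace_irreducible`, eng-5 g6) + CENTRE ⊇ 𝔷₀
  (`CMThetaCentre.centre_of_pair_kWeil`) + §1.
(«`Hg = U_E ∩ SU_K`-type statements for Weil-type members: the centre of `Hdg` is the subtorus of `U_E` acting trivially on the
Weil classes `W_K`», Moonen–Zarhin 1998 §4 Remark (1) and Criterion (crit2); 1999 (2.3).)

## References
* [MoonenZarhin1998WeilClasses] B. Moonen, Yu. Zarhin, J. reine angew. Math. 496 (1998), §4 Remark (1)–(2)
  [corpus: paper-arxiv-alg-geom_9612017 p0004 L53–85].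
* [MoonenZarhin1999LowDim] B. Moonen, Yu. Zarhin, Math. Ann. 315 (1999), §2 (2.3), (1.8).
* [Ribet1983] K. A. Ribet, Amer. J. Math. 105 (1983), Thm. 0, §3.
* [Deligne1982HodgeCycles] P. Deligne, LNM 900 (1982), I §3 Prop. 3.4, §4 (p. 30).
-/

noncomputable section

open scoped TensorProduct
open Module

namespace Literature.AlgebraicGeometry.Motives

namespace HodgeStructure

universe u

variable {V : Type u} [AddCommGroup V] [Module ℚ V] {n : ℤ}

/-! ### §1 The socket with one trace condition -/

/-- **THE `K`-WEIL SOCKET**: LIFT of the traceless factors and «centre ⊇ 𝔷₀» give: every `φ_ℂ`-commuting `ψ_ℂ`-skew operator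
`Y` of `V_ℂ` with `Σ_k tr(Y|W_{μ k}) = 0` lies in `𝔤_ℂ`. [cite: MoonenZarhin1999LowDim, §2 (2.3)] [cite: Ribet1983, Thm. 0]
[cite: Deligne1982HodgeCycles, §4 (p. 30)] -/
theorem CMThetaSocket.mem_spanC_of_lift_of_centre_kWeil [Module.Finite ℚ V] [HodgeTensorFacts.{u, u}] {ι : Type} [Fintype ι]
    [DecidableEq ι] (H : HodgeStructure V n) (hn : n = 1) (heff : H.IsEffective) (ψ : H.Polarization)
    {φ : Module.End ℚ V} (hφE : φ ∈ H.endAlg) {m : ℕ} (hE : ∀ a ∈ H.endAlg, ∃ q : Fin m → ℚ, a = ∑ k, q k • φ ^ (k : ℕ))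
    (μ : ι → ℂ) (hinj : Function.Injective μ) (hdist : ∀ k k', μ k' ≠ starRingEnd ℂ (μ k)) {n₀ : ℕ} (hn₀ : n₀ ≠ 0)
    (hrank : ∀ k, Module.finrank ℂ ↥(Module.End.eigenspace (φ.baseChange ℂ) (μ k) ⊓ H.piece 1 0) +
      Module.finrank ℂ ↥(Module.End.eigenspace (φ.baseChange ℂ) (μ k) ⊓ H.piece 0 1) = n₀)
    (htop : (⨆ kt : ι × Fin 2, Module.End.eigenspace (φ.baseChange ℂ)
      (if kt.2 = 0 then μ kt.1 else starRingEnd ℂ (μ kt.1))) = ⊤)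
    (𝔤 : Submodule ℚ (Module.End ℚ V))
    (hcomm : ∀ X ∈ 𝔤, ∀ a : H.endAlg, X * (a : Module.End ℚ V) = (a : Module.End ℚ V) * X)
    (hskew : ∀ X ∈ 𝔤, ∀ v w, ψ.form (X v) w + ψ.form v (X w) = 0)
    (hlift : ∀ k, ∀ Z : Module.End ℂ ↥(Module.End.eigenspace (φ.baseChange ℂ) (μ k)),
      LinearMap.trace ℂ _ Z = 0 → ∃ X ∈ spanC 𝔤,
        (∀ w : ↥(Module.End.eigenspace (φ.baseChange ℂ) (μ k)), X w = Z w) ∧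
        ∀ j, j ≠ k → ∀ w ∈ Module.End.eigenspace (φ.baseChange ℂ) (μ j), X w = 0)
    (hcentre : ∀ c : ι → ℂ, ∑ k, c k = 0 → ∃ C ∈ spanC 𝔤,
      ∀ k, ∀ w ∈ Module.End.eigenspace (φ.baseChange ℂ) (μ k), C w = c k • w)
    {Y : Module.End ℂ (ℂ ⊗[ℚ] V)} (hYφ : Y * φ.baseChange ℂ = φ.baseChange ℂ * Y)
    (hYskew : ∀ x y, ψ.form.baseChange ℂ (Y x) y + ψ.form.baseChange ℂ x (Y y) = 0)
    (htr : ∑ k, LinearMap.trace ℂ _ (Y.restrict fun x (hx : x ∈ Module.End.eigenspace (φ.baseChange ℂ) (μ k)) =>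
      UnitaryTheta.apply_mem_eigenspace_of_commute hYφ hx) = 0) : Y ∈ spanC 𝔤 := by
  classical
  set F := φ.baseChange ℂ with hF
  have hYW : ∀ k, ∀ w ∈ Module.End.eigenspace F (μ k), Y w ∈ Module.End.eigenspace F (μ k) := fun k w hw =>
    UnitaryTheta.apply_mem_eigenspace_of_commute hYφ hw
  have hfin : ∀ k, Module.finrank ℂ ↥(Module.End.eigenspace F (μ k)) = n₀ := fun k => by
    rw [hF, CMTheta.finrank_eigenspace_eq_add H hn heff hφE, hrank k]
  have hn₀C : (n₀ : ℂ) ≠ 0 := by exact_mod_cast hn₀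
  -- the central scalars `c k = tr(Y|W_{μ k}) / n₀` sum to zero
  set c : ι → ℂ := fun k => (n₀ : ℂ)⁻¹ * LinearMap.trace ℂ _ (Y.restrict (hYW k)) with hc
  have hcsum : ∑ k, c k = 0 := by
    simp only [hc, ← Finset.mul_sum]
    exact mul_eq_zero.2 (Or.inr htr)
  -- on each `W_{μ k}`: lift the traceless part of `Y|_{W_{μ k}}`
  have key : ∀ k, ∃ X ∈ spanC 𝔤, (∀ w ∈ Module.End.eigenspace F (μ k), X w = Y w - c k • w) ∧
      ∀ j, j ≠ k → ∀ w ∈ Module.End.eigenspace F (μ j), X w = 0 := by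
    intro k
    have hn₀' : (Module.finrank ℂ ↥(Module.End.eigenspace F (μ k)) : ℂ) ≠ 0 := by rw [hfin]; exact hn₀C
    obtain ⟨X, hX, hXk, hXj⟩ := hlift k _ (CMArith.trace_sub_smul_one_eq_zero hn₀' (Y.restrict (hYW k)))
    refine ⟨X, hX, fun w hw => ?_, hXj⟩
    rw [hXk ⟨w, hw⟩, LinearMap.sub_apply, LinearMap.smul_apply, Module.End.one_apply, Submodule.coe_sub,
      Submodule.coe_smul, LinearMap.coe_restrict_apply, hfin]
  choose X hX𝔤 hXk hXj using key
  obtain ⟨C, hC𝔤, hCk⟩ := hcentre c hcsum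
  set S : Module.End ℂ (ℂ ⊗[ℚ] V) := ∑ k, X k + C with hS
  have hS𝔤 : S ∈ spanC 𝔤 := Submodule.add_mem _ (Submodule.sum_mem _ fun k _ => hX𝔤 k) hC𝔤
  -- `S = Y` on every `W_{μ k}`
  have hSY : ∀ k, ∀ w ∈ Module.End.eigenspace F (μ k), S w = Y w := by
    intro k w hw
    rw [hS, LinearMap.add_apply, LinearMap.sum_apply, Finset.sum_eq_single k
      (fun j _ hjk => hXj j k (Ne.symm hjk) w hw) (fun h => absurd (Finset.mem_univ k) h), hXk k w hw, hCk k w hw,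
      sub_add_cancel]
  -- `D = S − Y` is `φ_ℂ`-commuting, `ψ_ℂ`-skew and zero on the CM type, hence zero
  have hD := CMThetaSocket.eq_zero_of_forall_eigenspace H hn heff ψ hφE hE μ hinj hdist htop (D := S - Y)
    (by rw [sub_mul, mul_sub, UnitaryTheta.commute_of_mem_spanC H hφE hcomm hS𝔤, hYφ])
    (fun x y => by
      have h3 := ThetaSubalgebra.formBaseChange_add_eq_zero_of_mem_spanC ψ hskew hS𝔤 x y
      have h4 := hYskew x y
      rw [LinearMap.sub_apply, LinearMap.sub_apply, map_sub, LinearMap.sub_apply, map_sub]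
      linear_combination h3 - h4)
    (fun k w hw => by rw [LinearMap.sub_apply, hSY k w hw, sub_self])
  rw [sub_eq_zero] at hD
  exact hD ▸ hS𝔤

/-! ### §2 Assembly: `𝔤_ℂ ⊇ (𝔲_E ∩ 𝔰𝔲_K)_ℂ` for one balanced place and a `K`-Weil structure -/

/-- **`𝔤_ℂ ⊇ (𝔲_E ∩ 𝔰𝔲_K)(V,ψ)_ℂ` FOR A CM FIELD WITH ONE BALANCED PLACE AND A `K`-WEIL STRUCTURE** (see the module docstring):
`|ι| ≤ 3`, places `k₀` (balanced) and `k₁ ≠ k₂` with `dim W_{μ k₁}^{1,0} + dim W_{μ k₂}^{1,0} = 2`, a `ψ`-skew `φ_K ∈ E` acting by one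
scalar `μ_K ≠ 0` on every `W_{μ k}`, any bracket-closed admissible `𝔤 ∋ Θ_ℂ`: every `φ_ℂ`-commuting `ψ_ℂ`-skew operator with
`Σ_k tr(Y|W_{μ k}) = 0` lies in `𝔤_ℂ`. No genericity hypothesis. [cite: MoonenZarhin1998WeilClasses, §4 Remark (1)]
[cite: MoonenZarhin1999LowDim, §2 (2.3)] [cite: Ribet1983, Thm. 0] [cite: Deligne1982HodgeCycles, I §3 Prop. 3.4] -/
theorem CMThetaOneBalancedKWeil.mem_spanC_of_commute_of_skew_of_traces [Module.Finite ℚ V] [HodgeTensorFacts.{u, u}]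
    {ι : Type} [Fintype ι] [DecidableEq ι] (hι : Fintype.card ι ≤ 3)
    (H : HodgeStructure V n) (hn : n = 1) (heff : H.IsEffective) (ψ : H.Polarization)
    {φ : Module.End ℚ V} (hφE : φ ∈ H.endAlg) {m : ℕ} (hE : ∀ a ∈ H.endAlg, ∃ q : Fin m → ℚ, a = ∑ k, q k • φ ^ (k : ℕ))
    (hEdim : Module.finrank ℚ H.endAlg = 2 * Fintype.card ι)
    (hdiv : ∀ a ∈ H.endAlg, a ≠ 0 → ∃ b : Module.End ℚ V, b * a = 1)
    (μ : ι → ℂ) (hinj : Function.Injective μ) (hdist : ∀ k k', μ k' ≠ starRingEnd ℂ (μ k))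
    (hrank : ∀ k, Module.finrank ℂ ↥(Module.End.eigenspace (φ.baseChange ℂ) (μ k) ⊓ H.piece 1 0) +
      Module.finrank ℂ ↥(Module.End.eigenspace (φ.baseChange ℂ) (μ k) ⊓ H.piece 0 1) = 2)
    (htop : (⨆ kt : ι × Fin 2, Module.End.eigenspace (φ.baseChange ℂ)
      (if kt.2 = 0 then μ kt.1 else starRingEnd ℂ (μ kt.1))) = ⊤)
    (𝔤 : Submodule ℚ (Module.End ℚ V)) (hbr : ∀ X ∈ 𝔤, ∀ X' ∈ 𝔤, X * X' - X' * X ∈ 𝔤)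
    (hcomm : ∀ X ∈ 𝔤, ∀ a : H.endAlg, X * (a : Module.End ℚ V) = (a : Module.End ℚ V) * X)
    (hskew : ∀ X ∈ 𝔤, ∀ v w, ψ.form (X v) w + ψ.form v (X w) = 0)
    {Θ : Module.End ℂ (ℂ ⊗[ℚ] V)} (hΘ : ∀ p, ∀ x ∈ H.piece p (n - p), Θ x = ((2 * p - n : ℤ) : ℂ) • x)
    (hΘ𝔤 : Θ ∈ spanC 𝔤)
    (k₀ : ι) (hk₀ : Module.finrank ℂ ↥(Module.End.eigenspace (φ.baseChange ℂ) (μ k₀) ⊓ H.piece 1 0) ≠ 0 ∧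
      Module.finrank ℂ ↥(Module.End.eigenspace (φ.baseChange ℂ) (μ k₀) ⊓ H.piece 0 1) ≠ 0)
    (hunb : ∀ k, k ≠ k₀ → Module.finrank ℂ ↥(Module.End.eigenspace (φ.baseChange ℂ) (μ k) ⊓ H.piece 1 0) = 0 ∨
      Module.finrank ℂ ↥(Module.End.eigenspace (φ.baseChange ℂ) (μ k) ⊓ H.piece 0 1) = 0)
    (k₁ k₂ : ι) (hk₁₂ : k₁ ≠ k₂) (hk₁ : k₁ ≠ k₀) (hk₂ : k₂ ≠ k₀)
    (hKW : Module.finrank ℂ ↥(Module.End.eigenspace (φ.baseChange ℂ) (μ k₁) ⊓ H.piece 1 0) +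
      Module.finrank ℂ ↥(Module.End.eigenspace (φ.baseChange ℂ) (μ k₂) ⊓ H.piece 1 0) = 2)
    {φK : Module.End ℚ V} (hφKE : φK ∈ H.endAlg) (hφKskew : ∀ v w, ψ.form (φK v) w + ψ.form v (φK w) = 0)
    {μK : ℂ} (hμK : μK ≠ 0)
    (hKE : ∀ k, ∀ w ∈ Module.End.eigenspace (φ.baseChange ℂ) (μ k), φK.baseChange ℂ w = μK • w)
    {Y : Module.End ℂ (ℂ ⊗[ℚ] V)} (hYφ : Y * φ.baseChange ℂ = φ.baseChange ℂ * Y)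
    (hYskew : ∀ x y, ψ.form.baseChange ℂ (Y x) y + ψ.form.baseChange ℂ x (Y y) = 0)
    (htr : ∑ k, LinearMap.trace ℂ _ (Y.restrict fun x (hx : x ∈ Module.End.eigenspace (φ.baseChange ℂ) (μ k)) =>
      UnitaryTheta.apply_mem_eigenspace_of_commute hYφ hx) = 0) : Y ∈ spanC 𝔤 := by
  classical
  have hirr := fun k U hUW hU => CMIrred.eigenspace_irreducible H hn heff ψ hφE hE μ hinj hdist htop 𝔤 hΘ hΘ𝔤 hcomm
    hskew k U hUW hU
  have hlift := fun k Z hZ => CMNoTwist.lift_of_unique_balanced hι H hn heff ψ hφE hE hdiv μ hinj hdist hrank htop 𝔤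
    hbr hcomm hskew hΘ hΘ𝔤 hirr k₀ hk₀ hunb k Z hZ
  -- `φ† ≠ φ`: `φ†` acts on `W_{μ k₀} ≠ 0` by `conj (μ k₀) ≠ μ k₀`
  have hφadj : ψ.adjoint φ ≠ φ := by
    intro h
    have hfin : Module.finrank ℂ ↥(Module.End.eigenspace (φ.baseChange ℂ) (μ k₀)) = 2 := by
      rw [CMTheta.finrank_eigenspace_eq_add H hn heff hφE, hrank k₀]
    obtain ⟨w, hw, hw0⟩ := Submodule.exists_mem_ne_zero_of_ne_bot
      (fun h0 => by rw [h0, finrank_bot] at hfin; exact two_ne_zero hfin.symm :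
        Module.End.eigenspace (φ.baseChange ℂ) (μ k₀) ≠ ⊥)
    have h1 := CMNoTwist.adjoint_baseChange_apply H hn heff ψ hφE hE μ hinj hdist two_ne_zero hrank htop k₀ w hw
    rw [h, Module.End.mem_eigenspace_iff.1 hw] at h1
    exact hdist k₀ k₀ (smul_left_injective ℂ hw0 h1)
  -- the weights: `k₀` balanced, `t_{k₁} + t_{k₂} = 0 ≠ t_{k₂}`
  have hk₀bal : Module.finrank ℂ ↥(Module.End.eigenspace (φ.baseChange ℂ) (μ k₀) ⊓ H.piece 1 0) =
      Module.finrank ℂ ↥(Module.End.eigenspace (φ.baseChange ℂ) (μ k₀) ⊓ H.piece 0 1) := by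
    have h := hrank k₀; have h1 := hk₀.1; have h2 := hk₀.2; omega
  have ht : ((Module.finrank ℂ ↥(Module.End.eigenspace (φ.baseChange ℂ) (μ k₁) ⊓ H.piece 1 0) : ℤ) -
        Module.finrank ℂ ↥(Module.End.eigenspace (φ.baseChange ℂ) (μ k₁) ⊓ H.piece 0 1)) +
      ((Module.finrank ℂ ↥(Module.End.eigenspace (φ.baseChange ℂ) (μ k₂) ⊓ H.piece 1 0) : ℤ) -
        Module.finrank ℂ ↥(Module.End.eigenspace (φ.baseChange ℂ) (μ k₂) ⊓ H.piece 0 1)) = 0 := by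
    have h1 := hrank k₁; have h2 := hrank k₂; have h := hKW; omega
  have ht0 : Module.finrank ℂ ↥(Module.End.eigenspace (φ.baseChange ℂ) (μ k₂) ⊓ H.piece 1 0) ≠
      Module.finrank ℂ ↥(Module.End.eigenspace (φ.baseChange ℂ) (μ k₂) ⊓ H.piece 0 1) := by
    have h := hrank k₂; have u := hunb k₂ hk₂; omega
  have hcentre := CMThetaCentre.centre_of_pair_kWeil hι H hn heff ψ hφE hE hEdim hdiv hφadj μ hinj hdist two_ne_zero
    hrank htop 𝔤 hcomm hskew hΘ hΘ𝔤 hlift k₀ k₁ k₂ hk₁₂ hk₁ hk₂ hk₀bal ht ht0 hφKE hφKskew hμK hKE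
  exact CMThetaSocket.mem_spanC_of_lift_of_centre_kWeil H hn heff ψ hφE hE μ hinj hdist two_ne_zero hrank htop 𝔤 hcomm
    hskew hlift hcentre hYφ hYskew htr

/-- **`Lie Hg(H)_ℂ ⊇ (𝔲_E ∩ 𝔰𝔲_K)(V,ψ)_ℂ` FOR A CM FIELD WITH ONE BALANCED PLACE AND A `K`-WEIL STRUCTURE** (`𝔤 = Lie Hg(H)`,
`Θ` its Hodge operator): every `φ_ℂ`-commuting `ψ_ℂ`-skew operator of `V_ℂ` with `Σ_k tr(Y|W_{μ k}) = 0` lies in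
`Lie Hg(H) ⊗ ℂ` — the Lie hypothesis of the cell's census ROW 13 for EVERY member. [cite: MoonenZarhin1998WeilClasses, §4 Remark (1)]
[cite: MoonenZarhin1999LowDim, §2 (2.3)] [cite: Ribet1983, Thm. 0] [cite: Deligne1982HodgeCycles, I §3 Prop. 3.4] -/
theorem CMThetaOneBalancedKWeil.mem_hodgeLieC_of_commute_of_skew_of_traces [Module.Finite ℚ V] [HodgeTensorFacts.{u, u}]
    {ι : Type} [Fintype ι] [DecidableEq ι] (hι : Fintype.card ι ≤ 3)
    (H : HodgeStructure V n) (hn : n = 1) (heff : H.IsEffective) (ψ : H.Polarization)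
    {φ : Module.End ℚ V} (hφE : φ ∈ H.endAlg) {m : ℕ} (hE : ∀ a ∈ H.endAlg, ∃ q : Fin m → ℚ, a = ∑ k, q k • φ ^ (k : ℕ))
    (hEdim : Module.finrank ℚ H.endAlg = 2 * Fintype.card ι)
    (hdiv : ∀ a ∈ H.endAlg, a ≠ 0 → ∃ b : Module.End ℚ V, b * a = 1)
    (μ : ι → ℂ) (hinj : Function.Injective μ) (hdist : ∀ k k', μ k' ≠ starRingEnd ℂ (μ k))
    (hrank : ∀ k, Module.finrank ℂ ↥(Module.End.eigenspace (φ.baseChange ℂ) (μ k) ⊓ H.piece 1 0) +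
      Module.finrank ℂ ↥(Module.End.eigenspace (φ.baseChange ℂ) (μ k) ⊓ H.piece 0 1) = 2)
    (htop : (⨆ kt : ι × Fin 2, Module.End.eigenspace (φ.baseChange ℂ)
      (if kt.2 = 0 then μ kt.1 else starRingEnd ℂ (μ kt.1))) = ⊤)
    (k₀ : ι) (hk₀ : Module.finrank ℂ ↥(Module.End.eigenspace (φ.baseChange ℂ) (μ k₀) ⊓ H.piece 1 0) ≠ 0 ∧
      Module.finrank ℂ ↥(Module.End.eigenspace (φ.baseChange ℂ) (μ k₀) ⊓ H.piece 0 1) ≠ 0)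
    (hunb : ∀ k, k ≠ k₀ → Module.finrank ℂ ↥(Module.End.eigenspace (φ.baseChange ℂ) (μ k) ⊓ H.piece 1 0) = 0 ∨
      Module.finrank ℂ ↥(Module.End.eigenspace (φ.baseChange ℂ) (μ k) ⊓ H.piece 0 1) = 0)
    (k₁ k₂ : ι) (hk₁₂ : k₁ ≠ k₂) (hk₁ : k₁ ≠ k₀) (hk₂ : k₂ ≠ k₀)
    (hKW : Module.finrank ℂ ↥(Module.End.eigenspace (φ.baseChange ℂ) (μ k₁) ⊓ H.piece 1 0) +
      Module.finrank ℂ ↥(Module.End.eigenspace (φ.baseChange ℂ) (μ k₂) ⊓ H.piece 1 0) = 2)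
    {φK : Module.End ℚ V} (hφKE : φK ∈ H.endAlg) (hφKskew : ∀ v w, ψ.form (φK v) w + ψ.form v (φK w) = 0)
    {μK : ℂ} (hμK : μK ≠ 0)
    (hKE : ∀ k, ∀ w ∈ Module.End.eigenspace (φ.baseChange ℂ) (μ k), φK.baseChange ℂ w = μK • w)
    {Y : Module.End ℂ (ℂ ⊗[ℚ] V)} (hYφ : Y * φ.baseChange ℂ = φ.baseChange ℂ * Y)
    (hYskew : ∀ x y, ψ.form.baseChange ℂ (Y x) y + ψ.form.baseChange ℂ x (Y y) = 0)
    (htr : ∑ k, LinearMap.trace ℂ _ (Y.restrict fun x (hx : x ∈ Module.End.eigenspace (φ.baseChange ℂ) (μ k)) =>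
      UnitaryTheta.apply_mem_eigenspace_of_commute hYφ hx) = 0) : Y ∈ H.hodgeLieC := by
  obtain ⟨Θ, hΘ⟩ := exists_hodgeTheta H
  have hΘ𝔤 : Θ ∈ spanC H.hodgeLie := (hodgeLieC_eq_spanC H) ▸ H.mem_hodgeLieC_of_forall_piece hΘ
  rw [hodgeLieC_eq_spanC]
  exact CMThetaOneBalancedKWeil.mem_spanC_of_commute_of_skew_of_traces hι H hn heff ψ hφE hE hEdim hdiv μ hinj hdist hrank
    htop H.hodgeLie (fun X hX X' hX' => H.commutator_mem_hodgeLie hX hX') (fun X hX a => H.commute_of_mem_hodgeLie hX a)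
    (fun X hX => form_apply_add_eq_zero_of_mem_hodgeLie ψ hX) hΘ hΘ𝔤 k₀ hk₀ hunb k₁ k₂ hk₁₂ hk₁ hk₂ hKW hφKE hφKskew hμK hKE
    hYφ hYskew htr

end HodgeStructure

end Literature.AlgebraicGeometry.Motives
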